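import Summits.RiemannHypothesis.RiemannHypothesis.Theorems.WeilFormatCDataO102BFrontData
import Summits.RiemannHypothesis.RiemannHypothesis.Theorems.WeilFormatCDataO102BTables
import Summits.RiemannHypothesis.RiemannHypothesis.Theorems.WeilFormatCDataO102BTabValid1
import Summits.RiemannHypothesis.RiemannHypothesis.Theorems.WeilFormatCDataO102BTabValid2
import Summits.RiemannHypothesis.RiemannHypothesis.Theorems.WeilFormatCDataO102BTabValid3
import Summits.RiemannHypothesis.RiemannHypothesis.Theorems.WeilFormatCDataA1RungCB
import Summits.RiemannHypothesis.RiemannHypothesis.Theorems.S2FormatCE0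
import Literature.NumberTheory.LFunctions.YoshidaWindowGramTailMSSines
import Literature.NumberTheory.LFunctions.YoshidaWindowGramMiddleJBox
import Literature.NumberTheory.LFunctions.YoshidaWindowGramTailJFactoredScaled
import Literature.NumberTheory.LFunctions.YoshidaWindowGramTailMSFactored
import Literature.NumberTheory.LFunctions.YoshidaWindowGramTailJDiagTight
import Summits.RiemannHypothesis.RiemannHypothesis.Theorems.FormatCPsdBands
import Summits.RiemannHypothesis.RiemannHypothesis.Theorems.WeilFormatCDiagShift
import HarnessLib

/-!
# Format C kernel rung `O102B` (a = 51/50, column-band layout): ASSEMBLY of the flat layout, part A of 12 (ladders of TabValid1, TabValid2, TabValid3; split of the 2697-line assembly at block boundaries by prover B g19 for the 400-line cap; blocks byte-identical): every propositional ladder of the kernel files (table/column validity, front door, sines, middle moments, column data, tail factors, Schur rows, (P) + diagonal shift), byte-identical statements and proofs, original order (A g22 restage_flat.py; weil-2 KERNEL-CHAIN-RULES #1)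

Window `a = 51/50`; prime powers in the window: 2, 3, 2^2, 5, 7; prime constant A = 2148/1000 (`WeilFormatC.primeCoeff_form_ge_cells_v2`); evaluator parameters S = 2^320, Kpi 160, Kser 190, kred 8, Kexp 55, J 150; full table modes < 257; light column table modes < 1027; units 2^-310 (Schur entries), 2^-154 (column digits, width 157), 2^-148 (tail-factor digits, width 151), 2^-64 (reciprocal weights), 2^-40 (tail base); order-J tail J = 4, θ = 1/2048, η = 1/10 | 4/1.
Design row: sr-gb-rung-a A g23 odd λ-run (parity cell 13 L-side): a = 51/50, μ = 2^-93, odd 256/512/1024, HIGHER precision S 2^320 c 310, MS tail, five prime powers; see HOME(A)/LADDER-CELL12-A-g23.md. Generated by sr-gb-rung-a prover A g22 with rh-explicit-weil-2 gen7's generator extended for the odd λ-run (--sector odd --mu-log2; HOME(A)/code-g22/gen7/gramgen7.py sha16 a23c13b0256hp001) from `#eval` of the tree's `Encl` functions; every datum is re-verified by the kernel in the theorem files (`decide +kernel`). Helper data of the rh-explicit Weil-positivity programme (format C, K-CELL-2), RH-free. [cite: Yoshida1992HermitianForms, §5 (5.15)-(5.16) p. 301; §7 pp. 305–312]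
-/

set_option linter.dupNamespace false
set_option exponentiation.threshold 1024
set_option maxRecDepth 200000

-- ===== from WeilFormatCDataO102BTabValid1 =====
namespace Summit.RiemannHypothesis.RiemannHypothesis.Theorems.WeilFormatCData.O102B
open Literature.NumberTheory.LFunctions Literature.NumberTheory.LFunctions.Yoshida1992 Encl Literature.Analysis.ValidatedNumerics.NumericsMP

/-- `π ∈ P`. -/
theorem pi_mem : MI.mem (2 ^ 320) Real.pi O102B.P := mem_pi_of_checkPi (by norm_num) tP

/-- `a ∈ A`. -/
theorem a_mem : MI.mem (2 ^ 320) O102B.a O102B.A := by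
  unfold a
  exact mem_of_checkFrac tA

/-- `0 < a` (window written out; `a` unfolds to it). -/
theorem a_pos : (0 : ℝ) < (((51 : ℤ) : ℝ) / (50 : ℕ)) := by
  positivity

/-- the constants are valid for `a`. -/
theorem consts_valid : ConstsValid (2 ^ 320) O102B.a O102B.ks O102B.C :=
  constsValid_of_checkConsts (prm := prm) (by norm_num [prm]) (by norm_num [prm]) pi_mem a_mem tC

/-- the prime data is valid for `a` (prime list written out). -/
theorem primeData : PrimeData O102B.a [⟨2, 1⟩, ⟨3, 1⟩, ⟨2, 2⟩, ⟨5, 1⟩, ⟨7, 1⟩] := primeData_of_checkSep (by norm_num) a_mem tK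

/-- the special-value table is valid below `20` (partial). -/
theorem tabv20 : TabValid (2 ^ 320) O102B.a O102B.ks 20 O102B.tab := by
  have h0 : TabValid (2 ^ 320) a ks 0 tab := TabValid.zero
  have h1 : TabValid (2 ^ 320) a ks (0 + 1) tab :=
    h0.extend fun n hn hnk ↦ idxValid_of_checkTable (prm := prm) (by norm_num [prm]) a_pos consts_valid tT0 hn hnk
  have h2 : TabValid (2 ^ 320) a ks (1 + 1) tab :=
    h1.extend fun n hn hnk ↦ idxValid_of_checkTable (prm := prm) (by norm_num [prm]) a_pos consts_valid tT1 hn hnk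
  have h3 : TabValid (2 ^ 320) a ks (2 + 1) tab :=
    h2.extend fun n hn hnk ↦ idxValid_of_checkTable (prm := prm) (by norm_num [prm]) a_pos consts_valid tT2 hn hnk
  have h4 : TabValid (2 ^ 320) a ks (3 + 1) tab :=
    h3.extend fun n hn hnk ↦ idxValid_of_checkTable (prm := prm) (by norm_num [prm]) a_pos consts_valid tT3 hn hnk
  have h5 : TabValid (2 ^ 320) a ks (4 + 1) tab :=
    h4.extend fun n hn hnk ↦ idxValid_of_checkTable (prm := prm) (by norm_num [prm]) a_pos consts_valid tT4 hn hnk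
  have h6 : TabValid (2 ^ 320) a ks (5 + 1) tab :=
    h5.extend fun n hn hnk ↦ idxValid_of_checkTable (prm := prm) (by norm_num [prm]) a_pos consts_valid tT5 hn hnk
  have h7 : TabValid (2 ^ 320) a ks (6 + 1) tab :=
    h6.extend fun n hn hnk ↦ idxValid_of_checkTable (prm := prm) (by norm_num [prm]) a_pos consts_valid tT6 hn hnk
  have h8 : TabValid (2 ^ 320) a ks (7 + 1) tab :=
    h7.extend fun n hn hnk ↦ idxValid_of_checkTable (prm := prm) (by norm_num [prm]) a_pos consts_valid tT7 hn hnk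
  have h9 : TabValid (2 ^ 320) a ks (8 + 1) tab :=
    h8.extend fun n hn hnk ↦ idxValid_of_checkTable (prm := prm) (by norm_num [prm]) a_pos consts_valid tT8 hn hnk
  have h10 : TabValid (2 ^ 320) a ks (9 + 1) tab :=
    h9.extend fun n hn hnk ↦ idxValid_of_checkTable (prm := prm) (by norm_num [prm]) a_pos consts_valid tT9 hn hnk
  have h11 : TabValid (2 ^ 320) a ks (10 + 1) tab :=
    h10.extend fun n hn hnk ↦ idxValid_of_checkTable (prm := prm) (by norm_num [prm]) a_pos consts_valid tT10 hn hnk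
  have h12 : TabValid (2 ^ 320) a ks (11 + 1) tab :=
    h11.extend fun n hn hnk ↦ idxValid_of_checkTable (prm := prm) (by norm_num [prm]) a_pos consts_valid tT11 hn hnk
  have h13 : TabValid (2 ^ 320) a ks (12 + 1) tab :=
    h12.extend fun n hn hnk ↦ idxValid_of_checkTable (prm := prm) (by norm_num [prm]) a_pos consts_valid tT12 hn hnk
  have h14 : TabValid (2 ^ 320) a ks (13 + 1) tab :=
    h13.extend fun n hn hnk ↦ idxValid_of_checkTable (prm := prm) (by norm_num [prm]) a_pos consts_valid tT13 hn hnk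
  have h15 : TabValid (2 ^ 320) a ks (14 + 1) tab :=
    h14.extend fun n hn hnk ↦ idxValid_of_checkTable (prm := prm) (by norm_num [prm]) a_pos consts_valid tT14 hn hnk
  have h16 : TabValid (2 ^ 320) a ks (15 + 1) tab :=
    h15.extend fun n hn hnk ↦ idxValid_of_checkTable (prm := prm) (by norm_num [prm]) a_pos consts_valid tT15 hn hnk
  have h17 : TabValid (2 ^ 320) a ks (16 + 1) tab :=
    h16.extend fun n hn hnk ↦ idxValid_of_checkTable (prm := prm) (by norm_num [prm]) a_pos consts_valid tT16 hn hnk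
  have h18 : TabValid (2 ^ 320) a ks (17 + 1) tab :=
    h17.extend fun n hn hnk ↦ idxValid_of_checkTable (prm := prm) (by norm_num [prm]) a_pos consts_valid tT17 hn hnk
  have h19 : TabValid (2 ^ 320) a ks (18 + 1) tab :=
    h18.extend fun n hn hnk ↦ idxValid_of_checkTable (prm := prm) (by norm_num [prm]) a_pos consts_valid tT18 hn hnk
  have h20 : TabValid (2 ^ 320) a ks (19 + 1) tab :=
    h19.extend fun n hn hnk ↦ idxValid_of_checkTable (prm := prm) (by norm_num [prm]) a_pos consts_valid tT19 hn hnk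
  exact h20

end Summit.RiemannHypothesis.RiemannHypothesis.Theorems.WeilFormatCData.O102B

-- ===== from WeilFormatCDataO102BTabValid2 =====
namespace Summit.RiemannHypothesis.RiemannHypothesis.Theorems.WeilFormatCData.O102B
open Literature.NumberTheory.LFunctions Literature.NumberTheory.LFunctions.Yoshida1992 Encl Literature.Analysis.ValidatedNumerics.NumericsMP

/-- the special-value table is valid below `50` (partial). -/
theorem tabv50 : TabValid (2 ^ 320) O102B.a O102B.ks 50 O102B.tab := by
  have h20 : TabValid (2 ^ 320) a ks 20 tab := tabv20
  have h21 : TabValid (2 ^ 320) a ks (20 + 1) tab :=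
    h20.extend fun n hn hnk ↦ idxValid_of_checkTable (prm := prm) (by norm_num [prm]) a_pos consts_valid tT20 hn hnk
  have h22 : TabValid (2 ^ 320) a ks (21 + 1) tab :=
    h21.extend fun n hn hnk ↦ idxValid_of_checkTable (prm := prm) (by norm_num [prm]) a_pos consts_valid tT21 hn hnk
  have h23 : TabValid (2 ^ 320) a ks (22 + 1) tab :=
    h22.extend fun n hn hnk ↦ idxValid_of_checkTable (prm := prm) (by norm_num [prm]) a_pos consts_valid tT22 hn hnk
  have h24 : TabValid (2 ^ 320) a ks (23 + 1) tab :=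
    h23.extend fun n hn hnk ↦ idxValid_of_checkTable (prm := prm) (by norm_num [prm]) a_pos consts_valid tT23 hn hnk
  have h25 : TabValid (2 ^ 320) a ks (24 + 1) tab :=
    h24.extend fun n hn hnk ↦ idxValid_of_checkTable (prm := prm) (by norm_num [prm]) a_pos consts_valid tT24 hn hnk
  have h26 : TabValid (2 ^ 320) a ks (25 + 1) tab :=
    h25.extend fun n hn hnk ↦ idxValid_of_checkTable (prm := prm) (by norm_num [prm]) a_pos consts_valid tT25 hn hnk
  have h27 : TabValid (2 ^ 320) a ks (26 + 1) tab :=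
    h26.extend fun n hn hnk ↦ idxValid_of_checkTable (prm := prm) (by norm_num [prm]) a_pos consts_valid tT26 hn hnk
  have h28 : TabValid (2 ^ 320) a ks (27 + 1) tab :=
    h27.extend fun n hn hnk ↦ idxValid_of_checkTable (prm := prm) (by norm_num [prm]) a_pos consts_valid tT27 hn hnk
  have h29 : TabValid (2 ^ 320) a ks (28 + 1) tab :=
    h28.extend fun n hn hnk ↦ idxValid_of_checkTable (prm := prm) (by norm_num [prm]) a_pos consts_valid tT28 hn hnk
  have h30 : TabValid (2 ^ 320) a ks (29 + 1) tab :=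
    h29.extend fun n hn hnk ↦ idxValid_of_checkTable (prm := prm) (by norm_num [prm]) a_pos consts_valid tT29 hn hnk
  have h31 : TabValid (2 ^ 320) a ks (30 + 1) tab :=
    h30.extend fun n hn hnk ↦ idxValid_of_checkTable (prm := prm) (by norm_num [prm]) a_pos consts_valid tT30 hn hnk
  have h32 : TabValid (2 ^ 320) a ks (31 + 1) tab :=
    h31.extend fun n hn hnk ↦ idxValid_of_checkTable (prm := prm) (by norm_num [prm]) a_pos consts_valid tT31 hn hnk
  have h33 : TabValid (2 ^ 320) a ks (32 + 1) tab :=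
    h32.extend fun n hn hnk ↦ idxValid_of_checkTable (prm := prm) (by norm_num [prm]) a_pos consts_valid tT32 hn hnk
  have h34 : TabValid (2 ^ 320) a ks (33 + 1) tab :=
    h33.extend fun n hn hnk ↦ idxValid_of_checkTable (prm := prm) (by norm_num [prm]) a_pos consts_valid tT33 hn hnk
  have h35 : TabValid (2 ^ 320) a ks (34 + 1) tab :=
    h34.extend fun n hn hnk ↦ idxValid_of_checkTable (prm := prm) (by norm_num [prm]) a_pos consts_valid tT34 hn hnk
  have h36 : TabValid (2 ^ 320) a ks (35 + 1) tab :=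
    h35.extend fun n hn hnk ↦ idxValid_of_checkTable (prm := prm) (by norm_num [prm]) a_pos consts_valid tT35 hn hnk
  have h37 : TabValid (2 ^ 320) a ks (36 + 1) tab :=
    h36.extend fun n hn hnk ↦ idxValid_of_checkTable (prm := prm) (by norm_num [prm]) a_pos consts_valid tT36 hn hnk
  have h38 : TabValid (2 ^ 320) a ks (37 + 1) tab :=
    h37.extend fun n hn hnk ↦ idxValid_of_checkTable (prm := prm) (by norm_num [prm]) a_pos consts_valid tT37 hn hnk
  have h39 : TabValid (2 ^ 320) a ks (38 + 1) tab :=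
    h38.extend fun n hn hnk ↦ idxValid_of_checkTable (prm := prm) (by norm_num [prm]) a_pos consts_valid tT38 hn hnk
  have h40 : TabValid (2 ^ 320) a ks (39 + 1) tab :=
    h39.extend fun n hn hnk ↦ idxValid_of_checkTable (prm := prm) (by norm_num [prm]) a_pos consts_valid tT39 hn hnk
  have h41 : TabValid (2 ^ 320) a ks (40 + 1) tab :=
    h40.extend fun n hn hnk ↦ idxValid_of_checkTable (prm := prm) (by norm_num [prm]) a_pos consts_valid tT40 hn hnk
  have h42 : TabValid (2 ^ 320) a ks (41 + 1) tab :=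
    h41.extend fun n hn hnk ↦ idxValid_of_checkTable (prm := prm) (by norm_num [prm]) a_pos consts_valid tT41 hn hnk
  have h43 : TabValid (2 ^ 320) a ks (42 + 1) tab :=
    h42.extend fun n hn hnk ↦ idxValid_of_checkTable (prm := prm) (by norm_num [prm]) a_pos consts_valid tT42 hn hnk
  have h44 : TabValid (2 ^ 320) a ks (43 + 1) tab :=
    h43.extend fun n hn hnk ↦ idxValid_of_checkTable (prm := prm) (by norm_num [prm]) a_pos consts_valid tT43 hn hnk
  have h45 : TabValid (2 ^ 320) a ks (44 + 1) tab :=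
    h44.extend fun n hn hnk ↦ idxValid_of_checkTable (prm := prm) (by norm_num [prm]) a_pos consts_valid tT44 hn hnk
  have h46 : TabValid (2 ^ 320) a ks (45 + 1) tab :=
    h45.extend fun n hn hnk ↦ idxValid_of_checkTable (prm := prm) (by norm_num [prm]) a_pos consts_valid tT45 hn hnk
  have h47 : TabValid (2 ^ 320) a ks (46 + 1) tab :=
    h46.extend fun n hn hnk ↦ idxValid_of_checkTable (prm := prm) (by norm_num [prm]) a_pos consts_valid tT46 hn hnk
  have h48 : TabValid (2 ^ 320) a ks (47 + 1) tab :=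
    h47.extend fun n hn hnk ↦ idxValid_of_checkTable (prm := prm) (by norm_num [prm]) a_pos consts_valid tT47 hn hnk
  have h49 : TabValid (2 ^ 320) a ks (48 + 1) tab :=
    h48.extend fun n hn hnk ↦ idxValid_of_checkTable (prm := prm) (by norm_num [prm]) a_pos consts_valid tT48 hn hnk
  have h50 : TabValid (2 ^ 320) a ks (49 + 1) tab :=
    h49.extend fun n hn hnk ↦ idxValid_of_checkTable (prm := prm) (by norm_num [prm]) a_pos consts_valid tT49 hn hnk
  exact h50

end Summit.RiemannHypothesis.RiemannHypothesis.Theorems.WeilFormatCData.O102B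

-- ===== from WeilFormatCDataO102BTabValid3 =====
namespace Summit.RiemannHypothesis.RiemannHypothesis.Theorems.WeilFormatCData.O102B
open Literature.NumberTheory.LFunctions Literature.NumberTheory.LFunctions.Yoshida1992 Encl Literature.Analysis.ValidatedNumerics.NumericsMP

/-- the special-value table is valid below `80` (partial). -/
theorem tabv80 : TabValid (2 ^ 320) O102B.a O102B.ks 80 O102B.tab := by
  have h50 : TabValid (2 ^ 320) a ks 50 tab := tabv50
  have h51 : TabValid (2 ^ 320) a ks (50 + 1) tab :=
    h50.extend fun n hn hnk ↦ idxValid_of_checkTable (prm := prm) (by norm_num [prm]) a_pos consts_valid tT50 hn hnk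
  have h52 : TabValid (2 ^ 320) a ks (51 + 1) tab :=
    h51.extend fun n hn hnk ↦ idxValid_of_checkTable (prm := prm) (by norm_num [prm]) a_pos consts_valid tT51 hn hnk
  have h53 : TabValid (2 ^ 320) a ks (52 + 1) tab :=
    h52.extend fun n hn hnk ↦ idxValid_of_checkTable (prm := prm) (by norm_num [prm]) a_pos consts_valid tT52 hn hnk
  have h54 : TabValid (2 ^ 320) a ks (53 + 1) tab :=
    h53.extend fun n hn hnk ↦ idxValid_of_checkTable (prm := prm) (by norm_num [prm]) a_pos consts_valid tT53 hn hnk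
  have h55 : TabValid (2 ^ 320) a ks (54 + 1) tab :=
    h54.extend fun n hn hnk ↦ idxValid_of_checkTable (prm := prm) (by norm_num [prm]) a_pos consts_valid tT54 hn hnk
  have h56 : TabValid (2 ^ 320) a ks (55 + 1) tab :=
    h55.extend fun n hn hnk ↦ idxValid_of_checkTable (prm := prm) (by norm_num [prm]) a_pos consts_valid tT55 hn hnk
  have h57 : TabValid (2 ^ 320) a ks (56 + 1) tab :=
    h56.extend fun n hn hnk ↦ idxValid_of_checkTable (prm := prm) (by norm_num [prm]) a_pos consts_valid tT56 hn hnk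
  have h58 : TabValid (2 ^ 320) a ks (57 + 1) tab :=
    h57.extend fun n hn hnk ↦ idxValid_of_checkTable (prm := prm) (by norm_num [prm]) a_pos consts_valid tT57 hn hnk
  have h59 : TabValid (2 ^ 320) a ks (58 + 1) tab :=
    h58.extend fun n hn hnk ↦ idxValid_of_checkTable (prm := prm) (by norm_num [prm]) a_pos consts_valid tT58 hn hnk
  have h60 : TabValid (2 ^ 320) a ks (59 + 1) tab :=
    h59.extend fun n hn hnk ↦ idxValid_of_checkTable (prm := prm) (by norm_num [prm]) a_pos consts_valid tT59 hn hnk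
  have h61 : TabValid (2 ^ 320) a ks (60 + 1) tab :=
    h60.extend fun n hn hnk ↦ idxValid_of_checkTable (prm := prm) (by norm_num [prm]) a_pos consts_valid tT60 hn hnk
  have h62 : TabValid (2 ^ 320) a ks (61 + 1) tab :=
    h61.extend fun n hn hnk ↦ idxValid_of_checkTable (prm := prm) (by norm_num [prm]) a_pos consts_valid tT61 hn hnk
  have h63 : TabValid (2 ^ 320) a ks (62 + 1) tab :=
    h62.extend fun n hn hnk ↦ idxValid_of_checkTable (prm := prm) (by norm_num [prm]) a_pos consts_valid tT62 hn hnk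
  have h64 : TabValid (2 ^ 320) a ks (63 + 1) tab :=
    h63.extend fun n hn hnk ↦ idxValid_of_checkTable (prm := prm) (by norm_num [prm]) a_pos consts_valid tT63 hn hnk
  have h65 : TabValid (2 ^ 320) a ks (64 + 1) tab :=
    h64.extend fun n hn hnk ↦ idxValid_of_checkTable (prm := prm) (by norm_num [prm]) a_pos consts_valid tT64 hn hnk
  have h66 : TabValid (2 ^ 320) a ks (65 + 1) tab :=
    h65.extend fun n hn hnk ↦ idxValid_of_checkTable (prm := prm) (by norm_num [prm]) a_pos consts_valid tT65 hn hnk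
  have h67 : TabValid (2 ^ 320) a ks (66 + 1) tab :=
    h66.extend fun n hn hnk ↦ idxValid_of_checkTable (prm := prm) (by norm_num [prm]) a_pos consts_valid tT66 hn hnk
  have h68 : TabValid (2 ^ 320) a ks (67 + 1) tab :=
    h67.extend fun n hn hnk ↦ idxValid_of_checkTable (prm := prm) (by norm_num [prm]) a_pos consts_valid tT67 hn hnk
  have h69 : TabValid (2 ^ 320) a ks (68 + 1) tab :=
    h68.extend fun n hn hnk ↦ idxValid_of_checkTable (prm := prm) (by norm_num [prm]) a_pos consts_valid tT68 hn hnk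
  have h70 : TabValid (2 ^ 320) a ks (69 + 1) tab :=
    h69.extend fun n hn hnk ↦ idxValid_of_checkTable (prm := prm) (by norm_num [prm]) a_pos consts_valid tT69 hn hnk
  have h71 : TabValid (2 ^ 320) a ks (70 + 1) tab :=
    h70.extend fun n hn hnk ↦ idxValid_of_checkTable (prm := prm) (by norm_num [prm]) a_pos consts_valid tT70 hn hnk
  have h72 : TabValid (2 ^ 320) a ks (71 + 1) tab :=
    h71.extend fun n hn hnk ↦ idxValid_of_checkTable (prm := prm) (by norm_num [prm]) a_pos consts_valid tT71 hn hnk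
  have h73 : TabValid (2 ^ 320) a ks (72 + 1) tab :=
    h72.extend fun n hn hnk ↦ idxValid_of_checkTable (prm := prm) (by norm_num [prm]) a_pos consts_valid tT72 hn hnk
  have h74 : TabValid (2 ^ 320) a ks (73 + 1) tab :=
    h73.extend fun n hn hnk ↦ idxValid_of_checkTable (prm := prm) (by norm_num [prm]) a_pos consts_valid tT73 hn hnk
  have h75 : TabValid (2 ^ 320) a ks (74 + 1) tab :=
    h74.extend fun n hn hnk ↦ idxValid_of_checkTable (prm := prm) (by norm_num [prm]) a_pos consts_valid tT74 hn hnk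
  have h76 : TabValid (2 ^ 320) a ks (75 + 1) tab :=
    h75.extend fun n hn hnk ↦ idxValid_of_checkTable (prm := prm) (by norm_num [prm]) a_pos consts_valid tT75 hn hnk
  have h77 : TabValid (2 ^ 320) a ks (76 + 1) tab :=
    h76.extend fun n hn hnk ↦ idxValid_of_checkTable (prm := prm) (by norm_num [prm]) a_pos consts_valid tT76 hn hnk
  have h78 : TabValid (2 ^ 320) a ks (77 + 1) tab :=
    h77.extend fun n hn hnk ↦ idxValid_of_checkTable (prm := prm) (by norm_num [prm]) a_pos consts_valid tT77 hn hnk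
  have h79 : TabValid (2 ^ 320) a ks (78 + 1) tab :=
    h78.extend fun n hn hnk ↦ idxValid_of_checkTable (prm := prm) (by norm_num [prm]) a_pos consts_valid tT78 hn hnk
  have h80 : TabValid (2 ^ 320) a ks (79 + 1) tab :=
    h79.extend fun n hn hnk ↦ idxValid_of_checkTable (prm := prm) (by norm_num [prm]) a_pos consts_valid tT79 hn hnk
  exact h80

end Summit.RiemannHypothesis.RiemannHypothesis.Theorems.WeilFormatCData.O102B
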